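import Summits.PneNP.PneNP.Theorems.NegLimitedDoorAMCover
import Summits.PneNP.PneNP.Theorems.NegLimitedDoorCorrelationTransfer
import Mathlib
import HarnessLib

/-!
# Route NegLimited — door support: negations from average-case monotone hardness
(rung F-N1/p3, ROUND-11 engine; cell pnp-ideate)

Circuit-level form of the cover-to-correlation transfer (`NegLimitedDoorCorrelationTransfer`,
Holley / four functions) combined with the landed Amano–Maruoka / Rossman cover
`NegLimitedDoor.amCoverMonPairs_holds` (a De Morgan circuit with `≤ t` NOT gates computing a
monotone `f` has its jumps covered by `≤ 2^(t+1) − 1` functions, each constant or computed by a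
`{∧₂,∨₂}` circuit of no larger size).  On the cube `ι → Bool` (`ι` any finite type) with a weight
`μ ≥ 0` satisfying the FKG lattice condition `μ x · μ y ≤ μ (x ⊓ y) · μ (x ⊔ y)` and a MONOTONE `f`
computed by a De Morgan circuit `C` with `negationCount ≤ t`:

* `exists_cover_member_condGap` — some cover member `g` has
  `μ(f=0)μ(f=1) ≤ (2^(t+1) − 1) · condGap μ f g`; when `μ(f=0)μ(f=1) > 0` the member is a MONOTONE
  CIRCUIT `M` with `M.size ≤ C.size` (`exists_monotone_circuit_condGap`; constants have gap `0`);
* `one_le_negations_mul_gap` — if every monotone circuit `M` with `M.size ≤ C.size` has conditional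
  gap `condGap μ f M.eval ≤ δ · μ(f=0)μ(f=1)` (i.e. `Pr_μ[M=1 | f=1] − Pr_μ[M=1 | f=0] ≤ δ`), then
  `1 ≤ (2^(t+1) − 1) δ`, hence `log₂(1/δ + 1) ≤ t + 1` (`logb_le_negations_add_one`);
* `one_le_negations_mul_corr` — the interface asked for by p3 (STATUS 2026-08-26T17:27:57Z): for
  `f` EXACTLY BALANCED (`∑ x with f x = true, μ x = ∑ x with f x = false, μ x`, total mass `> 0`),
  if every monotone circuit `M` with `M.size ≤ C.size` has agreement mass
  `∑ x with M.eval x = f x, μ x ≤ (1/2 + δ) · ∑ x, μ x`, then `1 ≤ (2^(t+1) − 1) · (2δ)` —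
  «(1/2+δ)-hardness of a balanced monotone `f` for monotone circuits no larger than `C` forces
  `2^(t+1) − 1 ≥ 1/(2δ)`» (Rossman, *Correlation bounds against monotone NC¹*, CCC 2015, Lemma 1.3
  shape; here via Holley's inequality, no coupling object).

HONEST FRAMING: a transfer lemma (negations ⇐ average-case monotone hardness); it proves no
hardness and does not touch the door's open stub `PlantedCliqueMonotoneAdvantageQuart`;
restricted-model statement, nothing here bears on P vs NP.
-/

set_option linter.dupNamespace false -- `Summit.PneNP.PneNP.…`: summit = sub-problem name (D-0017 single-conjunct layout)

namespace Summit.PneNP.PneNP.Theorems.NegLimitedDoor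

open Finset
open Literature.Computability.Complexity

/-! ### Filtered-sum readings of the bookkeeping masses -/

section Lattice

variable {α : Type*} [Fintype α]

/-- `massAt μ f b = ∑ x with f x = b, μ x`. -/
theorem massAt_eq_sum_filter (μ : α → ℝ) (f : α → Bool) (b : Bool) :
    massAt μ f b = ∑ x with f x = b, μ x := by
  rw [massAt, sum_filter]

/-- `jointAt μ f g b = ∑ x with (f x = b ∧ g x = true), μ x`. -/
theorem jointAt_eq_sum_filter (μ : α → ℝ) (f g : α → Bool) (b : Bool) :
    jointAt μ f g b = ∑ x with (f x = b ∧ g x = true), μ x := by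
  rw [jointAt, sum_filter]

/-- `agreeAt μ f g = ∑ x with g x = f x, μ x` (the `μ`-mass of agreement). -/
theorem agreeAt_eq_sum_filter (μ : α → ℝ) (f g : α → Bool) :
    agreeAt μ f g = ∑ x with g x = f x, μ x := by
  rw [agreeAt, sum_filter]

/-- The conditional gap of a constant function vanishes. -/
theorem condGap_const (μ : α → ℝ) (f : α → Bool) (b : Bool) :
    condGap μ f (fun _ => b) = 0 := by
  unfold condGap jointAt massAt
  cases b
  · simp
  · simp only [and_true]
    ring

end Lattice

/-! ### Circuit level: the Amano–Maruoka cover has a member with a large conditional gap -/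

section Circuits

variable {ι : Type} [Fintype ι] [DecidableEq ι]

/-- **Cover-to-correlation transfer, circuit form.**  For an FKG weight `μ ≥ 0` on the cube and a
monotone `f` computed by a De Morgan circuit `C` with `≤ t` NOT gates, some member `g` of the
Amano–Maruoka cover (constant, or computed by a monotone circuit of size `≤ C.size`) satisfies
`μ(f=0)μ(f=1) ≤ (2^(t+1) − 1) · condGap μ f g`. -/
theorem exists_cover_member_condGap (μ : (ι → Bool) → ℝ) (hμ0 : ∀ x, 0 ≤ μ x)
    (hμ : ∀ x y, μ x * μ y ≤ μ (x ⊓ y) * μ (x ⊔ y))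
    (f : (ι → Bool) → Bool) (hf : Monotone f) (C : Circuit ι) (hC : C.IsOver deMorganBasis)
    (t : ℕ) (ht : C.negationCount ≤ t) (hCf : C.Computes f) :
    ∃ g : (ι → Bool) → Bool,
      ((∃ b : Bool, ∀ x, g x = b) ∨
        ∃ M : Circuit ι, M.IsOver monotoneBasis ∧ M.size ≤ C.size ∧ M.Computes g) ∧
      massAt μ f false * massAt μ f true ≤ ((2 : ℝ) ^ (t + 1) - 1) * condGap μ f g := by
  obtain ⟨gs, hlen, hmem, hcov⟩ := amCoverMonPairs_holds ι C t hC ht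
  have hgs : ∀ g ∈ gs, Monotone g := by
    intro g hg
    rcases hmem g hg with ⟨b, hb⟩ | ⟨M, hM, -, hMg⟩
    · intro x y _
      rw [hb x, hb y]
    · intro x y hxy
      rw [← hMg x, ← hMg y]
      exact Circuit.monotone_eval_of_isOver_monotoneBasis M hM hxy
  have hcov' : ∀ x y, x ≤ y → f x = false → f y = true → ∃ g ∈ gs, g x = false ∧ g y = true := by
    intro x y hxy hx hy
    exact hcov x y hxy (by rw [hCf x, hx]) (by rw [hCf y, hy])
  have hmain := massAt_mul_massAt_le_sum_condGap μ hμ0 hμ f hf gs hgs hcov'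
  have hZ : 0 ≤ massAt μ f false * massAt μ f true :=
    mul_nonneg (massAt_nonneg hμ0 f false) (massAt_nonneg hμ0 f true)
  by_cases hnil : gs = []
  · subst hnil
    refine ⟨fun _ => false, Or.inl ⟨false, fun _ => rfl⟩, ?_⟩
    rw [condGap_const, mul_zero]
    simpa using hmain
  · -- some member carries at least the average gap
    have hN : (0 : ℝ) < gs.length := by exact_mod_cast List.length_pos_of_ne_nil hnil
    have hlhs : (gs.map fun _ => massAt μ f false * massAt μ f true).sum =
        (gs.length : ℝ) * (massAt μ f false * massAt μ f true) := by
      rw [List.map_const', List.sum_replicate, nsmul_eq_mul]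
    have hrhs : (gs.map fun g => (gs.length : ℝ) * condGap μ f g).sum =
        (gs.length : ℝ) * (gs.map (condGap μ f)).sum := by
      rw [List.sum_map_mul_left]
    have havg : (gs.map fun _ => massAt μ f false * massAt μ f true).sum ≤
        (gs.map fun g => (gs.length : ℝ) * condGap μ f g).sum := by
      rw [hlhs, hrhs]
      exact mul_le_mul_of_nonneg_left hmain hN.le
    obtain ⟨g, hg, hgap⟩ := List.exists_le_of_sum_le hnil _ _ havg
    refine ⟨g, hmem g hg, hgap.trans ?_⟩
    have hgap0 : 0 ≤ condGap μ f g := by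
      by_contra hneg
      have : (gs.length : ℝ) * condGap μ f g < 0 := mul_neg_of_pos_of_neg hN (not_le.mp hneg)
      linarith
    have hNle : (gs.length : ℝ) ≤ (2 : ℝ) ^ (t + 1) - 1 := by
      have h1 : gs.length + 1 ≤ 2 ^ (t + 1) := by
        have := Nat.one_le_two_pow (n := t + 1)
        omega
      have h2 : (gs.length : ℝ) + 1 ≤ (2 : ℝ) ^ (t + 1) := by exact_mod_cast h1
      linarith
    exact mul_le_mul_of_nonneg_right hNle hgap0

/-- **Positive-mass refinement.**  When `μ(f=0)μ(f=1) > 0` the member can be taken to be (the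
function of) a MONOTONE CIRCUIT `M` with `M.size ≤ C.size`: constant members have gap `0`. -/
theorem exists_monotone_circuit_condGap (μ : (ι → Bool) → ℝ) (hμ0 : ∀ x, 0 ≤ μ x)
    (hμ : ∀ x y, μ x * μ y ≤ μ (x ⊓ y) * μ (x ⊔ y))
    (f : (ι → Bool) → Bool) (hf : Monotone f) (hZ : 0 < massAt μ f false * massAt μ f true)
    (C : Circuit ι) (hC : C.IsOver deMorganBasis) (t : ℕ) (ht : C.negationCount ≤ t)
    (hCf : C.Computes f) :
    ∃ M : Circuit ι, M.IsOver monotoneBasis ∧ M.size ≤ C.size ∧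
      massAt μ f false * massAt μ f true ≤ ((2 : ℝ) ^ (t + 1) - 1) * condGap μ f M.eval := by
  obtain ⟨g, hg, hgap⟩ := exists_cover_member_condGap μ hμ0 hμ f hf C hC t ht hCf
  rcases hg with ⟨b, hb⟩ | ⟨M, hM, hMs, hMg⟩
  · exfalso
    have hgb : g = fun _ => b := funext hb
    rw [hgb, condGap_const, mul_zero] at hgap
    exact absurd hgap (not_le.mpr hZ)
  · refine ⟨M, hM, hMs, ?_⟩
    have hge : M.eval = g := funext hMg
    rwa [hge]

/-- **Negations from average-case monotone hardness (conditional-gap form).**  If `f` is monotone,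
`μ(f=0)μ(f=1) > 0`, and every monotone circuit `M` with `M.size ≤ C.size` has conditional gap
`condGap μ f M.eval ≤ δ · μ(f=0)μ(f=1)` — i.e. `Pr_μ[M=1 | f=1] − Pr_μ[M=1 | f=0] ≤ δ` — then a
De Morgan circuit `C` computing `f` with `negationCount ≤ t` forces `1 ≤ (2^(t+1) − 1)·δ`. -/
theorem one_le_negations_mul_gap (μ : (ι → Bool) → ℝ) (hμ0 : ∀ x, 0 ≤ μ x)
    (hμ : ∀ x y, μ x * μ y ≤ μ (x ⊓ y) * μ (x ⊔ y))
    (f : (ι → Bool) → Bool) (hf : Monotone f) (hZ : 0 < massAt μ f false * massAt μ f true)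
    (C : Circuit ι) (hC : C.IsOver deMorganBasis) (t : ℕ) (ht : C.negationCount ≤ t)
    (hCf : C.Computes f) (δ : ℝ)
    (hhard : ∀ M : Circuit ι, M.IsOver monotoneBasis → M.size ≤ C.size →
      condGap μ f M.eval ≤ δ * (massAt μ f false * massAt μ f true)) :
    1 ≤ ((2 : ℝ) ^ (t + 1) - 1) * δ := by
  obtain ⟨M, hM, hMs, hgap⟩ := exists_monotone_circuit_condGap μ hμ0 hμ f hf hZ C hC t ht hCf
  have hδ := hhard M hM hMs
  have hpow : (0 : ℝ) ≤ (2 : ℝ) ^ (t + 1) - 1 := by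
    have : (1 : ℝ) ≤ (2 : ℝ) ^ (t + 1) := one_le_pow₀ (by norm_num)
    linarith
  have h := hgap.trans (mul_le_mul_of_nonneg_left hδ hpow)
  by_contra hlt
  have hlt' : ((2 : ℝ) ^ (t + 1) - 1) * δ < 1 := not_le.mp hlt
  have : ((2 : ℝ) ^ (t + 1) - 1) * (δ * (massAt μ f false * massAt μ f true)) <
      1 * (massAt μ f false * massAt μ f true) := by
    rw [← mul_assoc]
    exact mul_lt_mul_of_pos_right hlt' hZ
  linarith

/-- The same bound in logarithmic form: `log₂(1/δ + 1) ≤ t + 1` (for `δ > 0`). -/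
theorem logb_le_negations_add_one (μ : (ι → Bool) → ℝ) (hμ0 : ∀ x, 0 ≤ μ x)
    (hμ : ∀ x y, μ x * μ y ≤ μ (x ⊓ y) * μ (x ⊔ y))
    (f : (ι → Bool) → Bool) (hf : Monotone f) (hZ : 0 < massAt μ f false * massAt μ f true)
    (C : Circuit ι) (hC : C.IsOver deMorganBasis) (t : ℕ) (ht : C.negationCount ≤ t)
    (hCf : C.Computes f) (δ : ℝ) (hδ : 0 < δ)
    (hhard : ∀ M : Circuit ι, M.IsOver monotoneBasis → M.size ≤ C.size →
      condGap μ f M.eval ≤ δ * (massAt μ f false * massAt μ f true)) :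
    Real.logb 2 (1 / δ + 1) ≤ (t : ℝ) + 1 := by
  have h := one_le_negations_mul_gap μ hμ0 hμ f hf hZ C hC t ht hCf δ hhard
  have hpos : 0 < 1 / δ + 1 := by positivity
  have hle : 1 / δ + 1 ≤ (2 : ℝ) ^ ((t : ℝ) + 1) := by
    rw [← Nat.cast_one (R := ℝ), ← Nat.cast_add, Real.rpow_natCast, Nat.cast_one]
    have : 1 / δ ≤ (2 : ℝ) ^ (t + 1) - 1 := by
      rw [div_le_iff₀ hδ]
      linarith
    linarith
  calc Real.logb 2 (1 / δ + 1)
      ≤ Real.logb 2 ((2 : ℝ) ^ ((t : ℝ) + 1)) := Real.logb_le_logb_of_le (by norm_num) hpos hle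
    _ = (t : ℝ) + 1 := Real.logb_rpow (by norm_num) (by norm_num)

/-- **Negations from correlation bounds (balanced form; the ROUND-11 interface).**  If `f` is
monotone and EXACTLY BALANCED under the FKG weight `μ ≥ 0` (`∑ x with f x = true, μ x =
∑ x with f x = false, μ x`, total mass `> 0`), `C` is a De Morgan circuit computing `f` with
`negationCount ≤ t`, and every monotone circuit `M` with `M.size ≤ C.size` has agreement mass
`∑ x with M.eval x = f x, μ x ≤ (1/2 + δ) · ∑ x, μ x`, then `1 ≤ (2^(t+1) − 1) · (2δ)`.
(Balanced: `Pr[M=1 | f=1] − Pr[M=1 | f=0] = 2 (Pr[M = f] − 1/2)`; the constant cover members have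
advantage `0` and drop out.) -/
theorem one_le_negations_mul_corr (μ : (ι → Bool) → ℝ) (hμ0 : ∀ x, 0 ≤ μ x)
    (hμ : ∀ x y, μ x * μ y ≤ μ (x ⊓ y) * μ (x ⊔ y))
    (f : (ι → Bool) → Bool) (hf : Monotone f)
    (hbal : ∑ x with f x = true, μ x = ∑ x with f x = false, μ x) (htot : 0 < ∑ x, μ x)
    (C : Circuit ι) (hC : C.IsOver deMorganBasis) (t : ℕ) (ht : C.negationCount ≤ t)
    (hCf : C.Computes f) (δ : ℝ)
    (hcorr : ∀ M : Circuit ι, M.IsOver monotoneBasis → M.size ≤ C.size →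
      ∑ x with M.eval x = f x, μ x ≤ (1 / 2 + δ) * ∑ x, μ x) :
    1 ≤ ((2 : ℝ) ^ (t + 1) - 1) * (2 * δ) := by
  have hbal' : massAt μ f false = massAt μ f true := by
    rw [massAt_eq_sum_filter, massAt_eq_sum_filter]
    exact hbal.symm
  have htot' : ∑ x, μ x = 2 * massAt μ f false := by
    rw [← massAt_false_add_massAt_true μ f, ← hbal']
    ring
  have hpos : 0 < massAt μ f false := by linarith
  have hZ : 0 < massAt μ f false * massAt μ f true := by
    rw [← hbal']
    exact mul_pos hpos hpos
  refine one_le_negations_mul_gap μ hμ0 hμ f hf hZ C hC t ht hCf (2 * δ) ?_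
  intro M hM hMs
  have h := hcorr M hM hMs
  rw [← agreeAt_eq_sum_filter μ f M.eval, htot'] at h
  rw [condGap_eq_of_balanced μ f M.eval hbal', ← hbal']
  -- `Z₀ (A − Z₀) ≤ 2δ Z₀²` from `A ≤ (1/2+δ)·2 Z₀ = Z₀ + 2δ Z₀`
  have h' : agreeAt μ f M.eval - massAt μ f false ≤ 2 * δ * massAt μ f false := by linarith
  calc massAt μ f false * (agreeAt μ f M.eval - massAt μ f false)
      ≤ massAt μ f false * (2 * δ * massAt μ f false) :=
        mul_le_mul_of_nonneg_left h' hpos.le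
    _ = 2 * δ * (massAt μ f false * massAt μ f false) := by ring

end Circuits

end Summit.PneNP.PneNP.Theorems.NegLimitedDoor
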